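import Mathlib
import Literature.NumberTheory.LFunctions.Zhang2022.Section13ZeroSumBound
import Literature.NumberTheory.LFunctions.Zhang2022.Section3Lemma33
import HarnessLib

/-!
# Zhang (2022) §13 p. 75, (13.11): the quadratic zero-sums
# `Σ_{ψ∈Ψ₁}Σ_{ρ∈𝔷(ψ)} |L(ρ+β₁,ψ)/L′(ρ,ψ)|·|F(ρ,ψ)|²·ω(ρ)` for a Dirichlet polynomial `F` of length `≤ P`
# — "(2.34), …, Lemma 5.9 … and 3.3" made explicit, with the mean value taken by ORTHOGONALITY

Topic `Literature/NumberTheory/LFunctions/Zhang2022` (Landau–Siegel audit tree; verdict-neutral).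
Y. Zhang, *Discrete mean estimates and the Landau–Siegel zero*, arXiv:2211.02515v1 (2022)
[Zhang2022LandauSiegel], §13 p. 75 (tex L3806–L3817) — an unrefereed manuscript under adjudication;
nothing here asserts or denies its Theorems 1–2. Lane ZHANG-L (WP14), GAP row G-L3t6-3 ((13.11) "we can
verify that `𝓔 = o(𝔓)`" — not carried out in print).

Every term of `𝓔` (display after (13.10)) is, after Cauchy's inequality on the POSITIVE weights
`w(ρ,ψ) = |L(ρ+β₁,ψ)/L′(ρ,ψ)|·ω(ρ)` (positivity: (2.34) and (2.15)), a product of square roots of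
quadratic zero-sums `Q(F) = Σ_{ψ∈Ψ₁}Σ_{ρ∈𝔷(ψ)} w(ρ,ψ)|F(ρ,ψ)|²` with `F(s,ψ) = Σ_{n≤P} c(n)ψ(n)n^{−s}` a
Dirichlet polynomial whose coefficients do not depend on `ψ` (`N(s+β_j,ψ)`, `B(s,ψ)` — coefficients
`b(n)χ(n)`, (15.1) —, `Σ_{n<T³}ψ(n)n^{−s−β_j−iv}`, and their products of length `≤ P`). This file proves
the bound for such `Q(F)` ONCE:

* `zeroSum_dirPoly_sq_le_of_prop22` — for `c′ ≥ 0` with `Skeleton.Prop22 c′` there are `K, C ≥ 0` with,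
  for all large `D`, every real primitive `χ`, every coefficient sequence `c` with `‖c(n)‖ ≤ c_max`:
  `Q(F) ≤ C·𝓛⁹·𝔓·Σ_{n≤P} ‖c(n)‖²·(n^{−(1+2α)} + n^{−(1−2α)}) + K·𝔓·(c_max·P)²·e^{−𝓛¹⁰/8}`;
  `zeroSum_dirPoly_sq_le_eventually` — the same for every sufficiently large `c′`, NO hypothesis.

Route (kernel-checked): per `ψ`, the generic zero-sum bound `zeroSum_weight_le_of_prop22`
(`Section13ZeroSumBound`, = the (2.34)/residue conversion + Lemma 5.9 on `𝒥(±α)`) with the holomorphic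
co-factor `H(s) = F(s,ψ)·F̄(1−s,ψ̄)`, `F̄(w,ψ̄) = Σ conj(c(n))ψ̄(n)n^{−w}`, which at a critical zero `ρ`
(`Re ρ = ½`, Proposition 2.2 (i)) equals `|F(ρ,ψ)|²`, while `ω(ρ) > 0` there; then on the two lines
`σ = ½ ± α`: `|H| ≤ ½(|F(s)|² + |F(1−s̄)|²)` and **Lemma 3.3 (i)** (orthogonality over the prime moduli of the
window, tree theorem `Skeleton.lemma33a_sum_le`, constant `1`): `Σ_{ψ∈Ψ₁}|F(s,ψ)|² ≤ 𝔓·Σ_{n≤P}|c(n)|²n^{−2σ}`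
— NOT the large sieve (ii), whose `P²` would lose `𝓛⁷⁷` against `𝔓 ≍ P²𝓛⁻⁷⁷` (`frakP_bounds`); finally
(7.4) `∫_{𝒥(±α)}|ω(s)||ds| ≤ 2πe^{1/4}` (`SmoothWeight.integral_norm_omega_segment_le_of_abs_le`) and
`#Ψ₁ ≤ 𝔓` (`cardPsiOneLe_holds`) for the error term.

Theorems only: no new definition, no new fact, axioms standard. WHAT THIS IS NOT: (13.11) or any of its
terms; the coefficient computations `Σ‖c(n)‖²n^{−1∓2α}` for the specific families.

## References

* Y. Zhang, arXiv:2211.02515v1 (2022), §13 p. 75, tex L3806–L3817; §3 Lemma 3.3 (i) p. 14; §7 (7.4);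
  §2 (2.9), (2.15), (2.34). [cite: Zhang2022LandauSiegel, §13 p.75]
-/

noncomputable section

open Complex Real Set Filter Topology MeasureTheory intervalIntegral ComplexConjugate

namespace Literature.NumberTheory.LFunctions.Zhang2022.Typed.Section13

open Skeleton GammaFactor Section8aStatements

/-! ## The Dirichlet polynomial `F(s,ψ) = Σ_{n≤P} c(n)ψ(n)n^{−s}` and its conjugate companion -/

section DirPoly

variable {D : ℕ} (x : Chr D) (c : ℕ → ℂ)

omit x c in
/-- `conj(n^{w}) = n^{conj w}` for a natural number `n`. [folklore] -/
private theorem conj_natCast_cpow' (n : ℕ) (w : ℂ) : conj ((n : ℂ) ^ w) = (n : ℂ) ^ conj w := by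
  have h := Complex.cpow_conj (n : ℂ) w (by rw [Complex.natCast_arg]; exact Real.pi_ne_zero.symm)
  rw [Complex.conj_natCast] at h
  exact h.symm

/-- `F(·,ψ) = Σ_{n≤P} c(n)ψ(n)n^{−s}` is entire (each `n ≥ 1`). [cite: Zhang2022LandauSiegel, §13 p.75] -/
theorem differentiable_dirPolyIcc :
    Differentiable ℂ fun s : ℂ =>
      ∑ n ∈ Finset.Icc 1 ⌊bigP D⌋₊, c n * x.ψ (n : ZMod x.p) * (n : ℂ) ^ (-s) := by
  refine Differentiable.fun_sum fun n hn => ?_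
  have hn : (n : ℂ) ≠ 0 := by
    have : 1 ≤ n := (Finset.mem_Icc.mp hn).1
    exact_mod_cast (by omega : n ≠ 0)
  exact (differentiable_id.neg.const_cpow (Or.inl hn)).const_mul _

/-- The conjugate companion `F̄(w,ψ̄) = Σ_{n≤P} conj(c(n))·ψ̄(n)·n^{−w}` is entire.
[cite: Zhang2022LandauSiegel, §13 p.75] -/
theorem differentiable_dirPolyIccBar :
    Differentiable ℂ fun w : ℂ =>
      ∑ n ∈ Finset.Icc 1 ⌊bigP D⌋₊, conj (c n) * conj (x.ψ (n : ZMod x.p)) * (n : ℂ) ^ (-w) := by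
  refine Differentiable.fun_sum fun n hn => ?_
  have hn : (n : ℂ) ≠ 0 := by
    have : 1 ≤ n := (Finset.mem_Icc.mp hn).1
    exact_mod_cast (by omega : n ≠ 0)
  exact (differentiable_id.neg.const_cpow (Or.inl hn)).const_mul _

/-- `F̄(w,ψ̄) = conj F(conj w, ψ)`. [cite: Zhang2022LandauSiegel, §13 p.75; §8 p.43 (reflection)] -/
theorem dirPolyIccBar_eq_conj (w : ℂ) :
    (∑ n ∈ Finset.Icc 1 ⌊bigP D⌋₊, conj (c n) * conj (x.ψ (n : ZMod x.p)) * (n : ℂ) ^ (-w)) =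
      conj (∑ n ∈ Finset.Icc 1 ⌊bigP D⌋₊, c n * x.ψ (n : ZMod x.p) * (n : ℂ) ^ (-conj w)) := by
  rw [map_sum]
  refine Finset.sum_congr rfl fun n _ => ?_
  rw [map_mul, map_mul, conj_natCast_cpow', map_neg, Complex.conj_conj]

/-- At a point of the critical line, `F(ρ,ψ)·F̄(1−ρ,ψ̄) = |F(ρ,ψ)|²` (`1 − ρ = conj ρ`).
[cite: Zhang2022LandauSiegel, §13 p.75 ("`|L(ρ+β₂,ψ)|² = L(ρ+β₂,ψ)L(1−ρ−β₂,ψ̄)`" pattern)] -/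
theorem dirPolyIcc_mul_bar_of_re_half {ρ : ℂ} (hρ : ρ.re = 1 / 2) :
    (∑ n ∈ Finset.Icc 1 ⌊bigP D⌋₊, c n * x.ψ (n : ZMod x.p) * (n : ℂ) ^ (-ρ)) *
        (∑ n ∈ Finset.Icc 1 ⌊bigP D⌋₊, conj (c n) * conj (x.ψ (n : ZMod x.p)) * (n : ℂ) ^ (-(1 - ρ))) =
      ((‖∑ n ∈ Finset.Icc 1 ⌊bigP D⌋₊, c n * x.ψ (n : ZMod x.p) * (n : ℂ) ^ (-ρ)‖ ^ 2 : ℝ) : ℂ) := by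
  have h1 : (1 : ℂ) - ρ = conj ρ := by
    apply Complex.ext
    · simp [hρ]; norm_num
    · simp
  rw [h1, dirPolyIccBar_eq_conj, Complex.conj_conj, Complex.mul_conj, Complex.normSq_eq_norm_sq]

/-- The trivial size bound `‖F(s,ψ)‖ ≤ c_max·P` for `Re s ≥ 0` (`‖c(n)‖ ≤ c_max`, `|ψ(n)| ≤ 1`,
`|n^{−s}| ≤ 1`). [cite: Zhang2022LandauSiegel, §13 p.75] -/
theorem norm_dirPolyIcc_le {Cmax : ℝ} (hc : ∀ n, ‖c n‖ ≤ Cmax) {s : ℂ} (hs : 0 ≤ s.re) :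
    ‖∑ n ∈ Finset.Icc 1 ⌊bigP D⌋₊, c n * x.ψ (n : ZMod x.p) * (n : ℂ) ^ (-s)‖ ≤ Cmax * bigP D := by
  have hC : 0 ≤ Cmax := (norm_nonneg _).trans (hc 0)
  have hP : 0 ≤ bigP D := (Real.exp_pos _).le
  calc ‖∑ n ∈ Finset.Icc 1 ⌊bigP D⌋₊, c n * x.ψ (n : ZMod x.p) * (n : ℂ) ^ (-s)‖
      ≤ ∑ n ∈ Finset.Icc 1 ⌊bigP D⌋₊, ‖c n * x.ψ (n : ZMod x.p) * (n : ℂ) ^ (-s)‖ := norm_sum_le _ _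
    _ ≤ ∑ n ∈ Finset.Icc 1 ⌊bigP D⌋₊, Cmax := Finset.sum_le_sum fun n hn => ?_
    _ = ⌊bigP D⌋₊ * Cmax := by simp
    _ ≤ bigP D * Cmax := mul_le_mul_of_nonneg_right (Nat.floor_le hP) hC
    _ = Cmax * bigP D := mul_comm _ _
  have hn : 1 ≤ n := (Finset.mem_Icc.mp hn).1
  rw [norm_mul, norm_mul]
  have h1 : ‖x.ψ (n : ZMod x.p)‖ ≤ 1 := DirichletCharacter.norm_le_one _ _
  have h2 : ‖(n : ℂ) ^ (-s)‖ ≤ 1 := by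
    rw [Complex.norm_natCast_cpow_of_pos (by omega)]
    exact Real.rpow_le_one_of_one_le_of_nonpos (by exact_mod_cast hn) (by simpa using hs)
  calc ‖c n‖ * ‖x.ψ (n : ZMod x.p)‖ * ‖(n : ℂ) ^ (-s)‖ ≤ Cmax * 1 * 1 := by
        gcongr
        exact hc n
    _ = Cmax := by ring

/-- The same bound for the conjugate companion: `‖F̄(w,ψ̄)‖ ≤ c_max·P` for `Re w ≥ 0`.
[cite: Zhang2022LandauSiegel, §13 p.75] -/
theorem norm_dirPolyIccBar_le {Cmax : ℝ} (hc : ∀ n, ‖c n‖ ≤ Cmax) {w : ℂ} (hw : 0 ≤ w.re) :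
    ‖∑ n ∈ Finset.Icc 1 ⌊bigP D⌋₊, conj (c n) * conj (x.ψ (n : ZMod x.p)) * (n : ℂ) ^ (-w)‖ ≤
      Cmax * bigP D := by
  rw [dirPolyIccBar_eq_conj, Complex.norm_conj]
  exact norm_dirPolyIcc_le x c hc (by simpa using hw)

end DirPoly

/-! ## The quadratic zero-sum bound -/

set_option maxHeartbeats 800000 in
/-- **The quadratic zero-sum for a Dirichlet polynomial of length `≤ P`, from Proposition 2.2** (§13 p.75:
"(2.34), Cauchy's inequality, …, Lemma 5.9, … and 3.3"): for `c′ ≥ 0` with `Skeleton.Prop22 c′` there are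
`K, C ≥ 0` such that for all large `D`, every real primitive `χ (mod D)`, every coefficient sequence `c`
with `‖c(n)‖ ≤ c_max` (`c_max ≥ 0`):
`Σ_{ψ∈Ψ₁}Σ_{ρ∈𝔷(ψ)} |L(ρ+β₁,ψ)/L′(ρ,ψ)|·|Σ_{n≤P}c(n)ψ(n)n^{−ρ}|²·|ω(ρ)|`
`≤ C·𝓛⁹·𝔓·Σ_{n≤P}‖c(n)‖²(n^{−(1+2α)} + n^{−(1−2α)}) + K·𝔓·(c_max·P)²·e^{−𝓛¹⁰/8}` — the generic zero-sum
bound (`zeroSum_weight_le_of_prop22`) with `H = F·F̄(1−·)` (`= |F|²` at the critical zeros, Prop. 2.2 (i);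
`ω(ρ) > 0`), `|H| ≤ ½(|F(s)|²+|F(1−s̄)|²)` on `𝒥(±α)`, Lemma 3.3 (i) by orthogonality
(`Skeleton.lemma33a_sum_le`), (7.4) for `∫|ω|`, and `#Ψ₁ ≤ 𝔓`.
[cite: Zhang2022LandauSiegel, §13 p.75, tex L3806–L3817; §3 Lemma 3.3 (i)] -/
theorem zeroSum_dirPoly_sq_le_of_prop22 {c' : ℝ} (hc' : 0 ≤ c') (h22 : Prop22 c') :
    ∃ K : ℝ, 0 ≤ K ∧ ∃ C : ℝ, 0 ≤ C ∧ ForAllLarge fun D _ χ => ∀ (c : ℕ → ℂ) (Cmax : ℝ),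
      0 ≤ Cmax → (∀ n, ‖c n‖ ≤ Cmax) →
      (∑ x ∈ finsetOf (PsiOne χ), ∑ ρ ∈ finsetOf (zeroSet D x),
          ‖x.ψ.LFunction (ρ + beta1 c' D) / deriv x.ψ.LFunction ρ‖ *
            ‖∑ n ∈ Finset.Icc 1 ⌊bigP D⌋₊, c n * x.ψ (n : ZMod x.p) * (n : ℂ) ^ (-ρ)‖ ^ 2 *
              ‖omegaW D ρ‖) ≤
        C * ell D ^ 9 * frakP D *
            (∑ n ∈ Finset.Icc 1 ⌊bigP D⌋₊,
              ‖c n‖ ^ 2 * ((n : ℝ) ^ (-(1 + 2 * alpha D)) + (n : ℝ) ^ (-(1 - 2 * alpha D)))) +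
          K * frakP D * (Cmax * bigP D) ^ 2 * Real.exp (-(ell D ^ 10 / 8)) := by
  obtain ⟨K, hK0, C₇, hC₇, D₁, hW⟩ := zeroSum_weight_le_of_prop22 hc' h22
  obtain ⟨D₂, h22i⟩ := h22.1
  refine ⟨K, hK0, 2 * (C₇ * (2 * π * Real.exp (1 / 4))), by positivity,
    max (max D₁ D₂) (max 3 ⌈Real.exp 2⌉₊), fun D _ χ hD hq hp c Cmax hCmax hc => ?_⟩
  have hD₁ : D₁ ≤ D := (le_max_left _ _).trans ((le_max_left _ _).trans hD)
  have hD₂ : D₂ ≤ D := (le_max_right _ _).trans ((le_max_left _ _).trans hD)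
  have hD3 : 3 ≤ D := (le_max_left _ _).trans ((le_max_right _ _).trans hD)
  have hDe : ⌈Real.exp 2⌉₊ ≤ D := (le_max_right _ _).trans ((le_max_right _ _).trans hD)
  have hℓ2 : 2 ≤ ell D := by
    have h1 : Real.exp 2 ≤ D := (Nat.le_ceil _).trans (by exact_mod_cast hDe)
    have hD0 : (0 : ℝ) < D := (Real.exp_pos _).trans_le h1
    rw [ell, Real.le_log_iff_exp_le hD0]; exact h1
  have hℓ1 : 1 < ell D := one_lt_ell hD3
  have hℓpos : 0 < ell D := by linarith
  have hlogP : Real.log (bigP D) = ell D ^ 9 := by rw [bigP, Real.log_exp]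
  have hα : 0 < alpha D := by
    rw [alpha, hlogP]; exact div_pos Real.pi_pos (pow_pos hℓpos 9)
  have hα4 : alpha D ≤ 1 / 4 := by
    rw [alpha, hlogP, div_le_iff₀ (pow_pos hℓpos 9)]
    have h512 : (512 : ℝ) ≤ ell D ^ 9 := by
      calc (512 : ℝ) = 2 ^ 9 := by norm_num
        _ ≤ ell D ^ 9 := pow_le_pow_left₀ (by norm_num) hℓ2 9
    nlinarith [Real.pi_lt_four]
  have hℓ1pos : 0 < ell1 D := by rw [ell1]; positivity
  have hℓ2pos : 0 < ell2 D := by rw [ell2]; positivity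
  have hℓt : ell1 D < 2 * π * t0 D := by
    have h1 : ell1 D ≤ t0 D := pow_le_pow_right₀ hℓ1.le (by norm_num)
    have h2 : 0 < t0 D := lt_of_lt_of_le hℓ1pos h1
    nlinarith [Real.pi_gt_three]
  have hαℓ2 : |alpha D| ≤ ell2 D := by
    rw [abs_of_pos hα, ell2]
    have : (1 : ℝ) ≤ ell D ^ 400 := one_le_pow₀ hℓ1.le
    linarith
  have hαℓ2' : |(-alpha D)| ≤ ell2 D := by rw [abs_neg]; exact hαℓ2
  have hP0 : 0 ≤ frakP D := frakP_nonneg D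
  -- names
  set T := finsetOf (PsiOne χ) with hT
  set N := ⌊bigP D⌋₊ with hN
  set F : Chr D → ℂ → ℂ := fun x s =>
    ∑ n ∈ Finset.Icc 1 N, c n * x.ψ (n : ZMod x.p) * (n : ℂ) ^ (-s) with hF
  set Fb : Chr D → ℂ → ℂ := fun x w =>
    ∑ n ∈ Finset.Icc 1 N, conj (c n) * conj (x.ψ (n : ZMod x.p)) * (n : ℂ) ^ (-w) with hFb
  set H : Chr D → ℂ → ℂ := fun x s => F x s * Fb x (1 - s) with hH
  set Hmax : ℝ := (Cmax * bigP D) ^ 2 with hHmax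
  have hHmax0 : 0 ≤ Hmax := by positivity
  set S : ℝ := ∑ n ∈ Finset.Icc 1 N,
    ‖c n‖ ^ 2 * ((n : ℝ) ^ (-(1 + 2 * alpha D)) + (n : ℝ) ^ (-(1 - 2 * alpha D))) with hS
  have hS0 : 0 ≤ S := Finset.sum_nonneg fun n _ => by positivity
  -- the co-factor is holomorphic and bounded on the strip
  have hHdiff : ∀ x : Chr D, ∀ z : ℂ, 0 < z.im → DifferentiableAt ℂ (H x) z := by
    intro x z _
    have h1 : DifferentiableAt ℂ (F x) z := (differentiable_dirPolyIcc x c) z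
    have h2 : DifferentiableAt ℂ (fun s => Fb x (1 - s)) z :=
      ((differentiable_dirPolyIccBar x c).comp (differentiable_const _ |>.sub differentiable_id)) z
    exact h1.mul h2
  have hHb : ∀ x : Chr D, ∀ s : ℂ, |s.re - 1 / 2| ≤ alpha D → |s.im - 2 * π * t0 D| ≤ ell1 D + 1 →
      ‖H x s‖ ≤ Hmax := by
    intro x s hσ _
    obtain ⟨h1, h2⟩ := abs_le.mp hσ
    have hre : 0 ≤ s.re := by linarith
    have hre' : 0 ≤ (1 - s).re := by simp; linarith
    rw [hH]
    show ‖F x s * Fb x (1 - s)‖ ≤ Hmax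
    rw [norm_mul, hHmax, sq]
    exact mul_le_mul (norm_dirPolyIcc_le x c hc hre) (norm_dirPolyIccBar_le x c hc hre')
      (norm_nonneg _) (mul_nonneg hCmax (Real.exp_pos _).le)
  -- per character: the real zero-sum is the norm of the complex one, bounded by `hW`
  have hx : ∀ x ∈ T,
      (∑ ρ ∈ finsetOf (zeroSet D x),
          ‖x.ψ.LFunction (ρ + beta1 c' D) / deriv x.ψ.LFunction ρ‖ * ‖F x ρ‖ ^ 2 * ‖omegaW D ρ‖) ≤
        C₇ * ell D ^ 9 *
            ((∫ v in (-ell1 D)..ell1 D,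
                ‖H x ((alpha D : ℂ) + s0 D + v * I)‖ * ‖omegaW D ((alpha D : ℂ) + s0 D + v * I)‖) +
              (∫ v in (-ell1 D)..ell1 D,
                ‖H x (((-alpha D : ℝ) : ℂ) + s0 D + v * I)‖ *
                  ‖omegaW D (((-alpha D : ℝ) : ℂ) + s0 D + v * I)‖)) +
          K * Hmax * Real.exp (-(ell D ^ 10 / 8)) := by
    intro x hxT
    have hxΨ : x ∈ PsiOne χ := mem_of_mem_finsetOf hxT
    have hWx := hW D χ hD₁ hq hp x hxΨ (H x) Hmax hHmax0 (hHdiff x) (hHb x)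
    have hfin : (zeroSet D x).Finite := zerosFinite_holds D x
    -- the complex sum is the real sum
    have hsum : (∑ ρ ∈ finsetOf (zeroSet D x),
        ((‖x.ψ.LFunction (ρ + beta1 c' D) / deriv x.ψ.LFunction ρ‖ : ℝ) : ℂ) * H x ρ * omegaW D ρ) =
        (((∑ ρ ∈ finsetOf (zeroSet D x),
          ‖x.ψ.LFunction (ρ + beta1 c' D) / deriv x.ψ.LFunction ρ‖ * ‖F x ρ‖ ^ 2 *
            ‖omegaW D ρ‖ : ℝ)) : ℂ) := by
      push_cast
      refine Finset.sum_congr rfl fun ρ hρ => ?_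
      have hρz : ρ ∈ zeroSet D x := (mem_finsetOf hfin).mp hρ
      have hre : ρ.re = 1 / 2 :=
        h22i D χ hD₂ hq hp x hxΨ ρ (mem_prodZeroSetOmega_of_mem_zeroSet χ hρz)
      obtain ⟨hωre, hωim⟩ := omegaW_re_pos hD3 hre
      have hω : omegaW D ρ = ((‖omegaW D ρ‖ : ℝ) : ℂ) := by
        have h1 : omegaW D ρ = (((omegaW D ρ).re : ℝ) : ℂ) :=
          Complex.ext (by simp) (by simp [hωim])
        have h2 : ‖omegaW D ρ‖ = (omegaW D ρ).re := by
          rw [h1, Complex.norm_real, Real.norm_of_nonneg hωre.le]; simp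
        rw [h2]; exact h1
      have hHρ : H x ρ = ((‖F x ρ‖ ^ 2 : ℝ) : ℂ) := by
        rw [hH]
        exact dirPolyIcc_mul_bar_of_re_half x c hre
      rw [hHρ]
      conv_lhs => rw [hω]
      push_cast
      ring
    have hreal : ‖(∑ ρ ∈ finsetOf (zeroSet D x),
        ((‖x.ψ.LFunction (ρ + beta1 c' D) / deriv x.ψ.LFunction ρ‖ : ℝ) : ℂ) * H x ρ * omegaW D ρ)‖ =
        ∑ ρ ∈ finsetOf (zeroSet D x),
          ‖x.ψ.LFunction (ρ + beta1 c' D) / deriv x.ψ.LFunction ρ‖ * ‖F x ρ‖ ^ 2 * ‖omegaW D ρ‖ := by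
      rw [hsum, Complex.norm_real, Real.norm_of_nonneg]
      exact Finset.sum_nonneg fun ρ _ => by positivity
    rw [← hreal]
    exact hWx
  -- the line integrals, summed over `Ψ₁`: orthogonality (Lemma 3.3 (i)) and (7.4)
  have hline : ∀ z : ℝ, (z = alpha D ∨ z = -alpha D) →
      (∑ x ∈ T, ∫ v in (-ell1 D)..ell1 D,
          ‖H x ((z : ℂ) + s0 D + v * I)‖ * ‖omegaW D ((z : ℂ) + s0 D + v * I)‖) ≤
        frakP D * S * (2 * π * Real.exp (1 / 4)) := by
    intro z hz
    have hzabs : |z| ≤ ell2 D := by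
      rcases hz with h | h
      · rw [h]; exact hαℓ2
      · rw [h]; exact hαℓ2'
    have hzα : |z| = alpha D := by
      rcases hz with h | h
      · rw [h, abs_of_pos hα]
      · rw [h, abs_neg, abs_of_pos hα]
    -- continuity of the integrands
    have hcont : ∀ x : Chr D, ContinuousOn (fun v : ℝ =>
        ‖H x ((z : ℂ) + s0 D + v * I)‖ * ‖omegaW D ((z : ℂ) + s0 D + v * I)‖)
        (Icc (-ell1 D) (ell1 D)) := fun x =>
      continuousOn_normH_mul_normOmega (D := D) (H x) (hHdiff x) z hℓt
    have hint : ∀ x ∈ T, IntervalIntegrable (fun v : ℝ =>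
        ‖H x ((z : ℂ) + s0 D + v * I)‖ * ‖omegaW D ((z : ℂ) + s0 D + v * I)‖) volume
        (-ell1 D) (ell1 D) := fun x _ =>
      ((hcont x).mono (by rw [Set.uIcc_of_le (by linarith)])).intervalIntegrable
    rw [← intervalIntegral.integral_finsetSum hint]
    -- pointwise bound on the line
    have hpt : ∀ v ∈ Icc (-ell1 D) (ell1 D),
        (∑ x ∈ T, ‖H x ((z : ℂ) + s0 D + v * I)‖ * ‖omegaW D ((z : ℂ) + s0 D + v * I)‖) ≤
          frakP D * S * ‖omegaW D ((z : ℂ) + s0 D + v * I)‖ := by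
      intro v _
      set s : ℂ := (z : ℂ) + s0 D + v * I with hs
      have hsre : s.re = 1 / 2 + z := by rw [hs]; simp [s0_re]; ring
      rw [← Finset.sum_mul]
      refine mul_le_mul_of_nonneg_right ?_ (norm_nonneg _)
      -- `Σ_ψ |H| ≤ ½ Σ_ψ (|F(s)|² + |F(1 − s̄)|²)`
      have hHle : ∀ x : Chr D, ‖H x s‖ ≤ (‖F x s‖ ^ 2 + ‖F x (1 - conj s)‖ ^ 2) / 2 := by
        intro x
        rw [hH]
        show ‖F x s * Fb x (1 - s)‖ ≤ (‖F x s‖ ^ 2 + ‖F x (1 - conj s)‖ ^ 2) / 2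
        rw [norm_mul]
        have hFb : ‖Fb x (1 - s)‖ = ‖F x (1 - conj s)‖ := by
          rw [hFb, hF]
          show ‖∑ n ∈ Finset.Icc 1 N, conj (c n) * conj (x.ψ (n : ZMod x.p)) * (n : ℂ) ^ (-(1 - s))‖ =
            ‖∑ n ∈ Finset.Icc 1 N, c n * x.ψ (n : ZMod x.p) * (n : ℂ) ^ (-(1 - conj s))‖
          rw [dirPolyIccBar_eq_conj, Complex.norm_conj, map_sub, map_one]
        rw [hFb]
        nlinarith [two_mul_le_add_sq ‖F x s‖ ‖F x (1 - conj s)‖, norm_nonneg (F x s),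
          norm_nonneg (F x (1 - conj s))]
      have h1 : ∑ x ∈ T, ‖F x s‖ ^ 2 ≤
          frakP D * ∑ n ∈ Finset.Icc 1 N, ‖c n‖ ^ 2 * (n : ℝ) ^ (-2 * s.re) :=
        lemma33a_sum_le T s c
      have h2 : ∑ x ∈ T, ‖F x (1 - conj s)‖ ^ 2 ≤
          frakP D * ∑ n ∈ Finset.Icc 1 N, ‖c n‖ ^ 2 * (n : ℝ) ^ (-2 * (1 - conj s).re) :=
        lemma33a_sum_le T (1 - conj s) c
      have he1 : -2 * s.re = -(1 + 2 * z) := by rw [hsre]; ring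
      have he2 : -2 * (1 - conj s).re = -(1 - 2 * z) := by
        rw [Complex.sub_re, Complex.one_re, Complex.conj_re, hsre]; ring
      rw [he1] at h1
      rw [he2] at h2
      have hS' : (∑ n ∈ Finset.Icc 1 N, ‖c n‖ ^ 2 * (n : ℝ) ^ (-(1 + 2 * z))) +
          (∑ n ∈ Finset.Icc 1 N, ‖c n‖ ^ 2 * (n : ℝ) ^ (-(1 - 2 * z))) = S := by
        rw [hS, ← Finset.sum_add_distrib]
        refine Finset.sum_congr rfl fun n _ => ?_
        rcases hz with h | h
        · rw [h]; ring
        · rw [h, show -(1 + 2 * -alpha D) = -(1 - 2 * alpha D) by ring,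
            show -(1 - 2 * -alpha D) = -(1 + 2 * alpha D) by ring]; ring
      calc ∑ x ∈ T, ‖H x s‖ ≤ ∑ x ∈ T, (‖F x s‖ ^ 2 + ‖F x (1 - conj s)‖ ^ 2) / 2 :=
            Finset.sum_le_sum fun x _ => hHle x
        _ = ((∑ x ∈ T, ‖F x s‖ ^ 2) + ∑ x ∈ T, ‖F x (1 - conj s)‖ ^ 2) / 2 := by
            rw [← Finset.sum_add_distrib, Finset.sum_div]
        _ ≤ (frakP D * (∑ n ∈ Finset.Icc 1 N, ‖c n‖ ^ 2 * (n : ℝ) ^ (-(1 + 2 * z))) +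
              frakP D * (∑ n ∈ Finset.Icc 1 N, ‖c n‖ ^ 2 * (n : ℝ) ^ (-(1 - 2 * z)))) / 2 := by
            gcongr
        _ = frakP D * S / 2 := by rw [← hS']; ring
        _ ≤ frakP D * S := by nlinarith [mul_nonneg hP0 hS0]
    -- integrate
    have hωcont : Continuous fun v : ℝ => ‖omegaW D ((z : ℂ) + s0 D + v * I)‖ :=
      ((Ded81Edge.continuous_omega (ell2 D) (t0 D)).comp
        (by fun_prop : Continuous fun v : ℝ => (z : ℂ) + s0 D + v * I)).norm
    have hint2 : IntervalIntegrable (fun v : ℝ => frakP D * S * ‖omegaW D ((z : ℂ) + s0 D + v * I)‖)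
        volume (-ell1 D) (ell1 D) := (continuous_const.mul hωcont).intervalIntegrable _ _
    have hintS : IntervalIntegrable (fun v : ℝ => ∑ x ∈ T,
        ‖H x ((z : ℂ) + s0 D + v * I)‖ * ‖omegaW D ((z : ℂ) + s0 D + v * I)‖) volume
        (-ell1 D) (ell1 D) := by
      refine (continuousOn_finsetSum T fun x _ => hcont x).mono ?_ |>.intervalIntegrable
      rw [Set.uIcc_of_le (by linarith)]
    have hmono := intervalIntegral.integral_mono_on (by linarith : -ell1 D ≤ ell1 D) hintS hint2 hpt
    refine hmono.trans ?_
    rw [intervalIntegral.integral_const_mul]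
    have hω74 : ∫ v in (-ell1 D)..ell1 D, ‖omegaW D ((z : ℂ) + s0 D + v * I)‖ ≤
        2 * π * Real.exp (1 / 4) := by
      have h := SmoothWeight.integral_norm_omega_segment_le_of_abs_le hℓ2pos (t0 D) hzabs hℓ1pos.le
      simpa only [omegaW, s0] using h
    exact mul_le_mul_of_nonneg_left hω74 (mul_nonneg hP0 hS0)
  -- assemble
  have hcard : (T.card : ℝ) ≤ frakP D := cardPsiOneLe_holds D χ
  calc (∑ x ∈ T, ∑ ρ ∈ finsetOf (zeroSet D x),
          ‖x.ψ.LFunction (ρ + beta1 c' D) / deriv x.ψ.LFunction ρ‖ * ‖F x ρ‖ ^ 2 * ‖omegaW D ρ‖)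
      ≤ ∑ x ∈ T, (C₇ * ell D ^ 9 *
            ((∫ v in (-ell1 D)..ell1 D,
                ‖H x ((alpha D : ℂ) + s0 D + v * I)‖ * ‖omegaW D ((alpha D : ℂ) + s0 D + v * I)‖) +
              (∫ v in (-ell1 D)..ell1 D,
                ‖H x (((-alpha D : ℝ) : ℂ) + s0 D + v * I)‖ *
                  ‖omegaW D (((-alpha D : ℝ) : ℂ) + s0 D + v * I)‖)) +
          K * Hmax * Real.exp (-(ell D ^ 10 / 8))) := Finset.sum_le_sum hx
    _ = C₇ * ell D ^ 9 *
          ((∑ x ∈ T, ∫ v in (-ell1 D)..ell1 D,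
              ‖H x ((alpha D : ℂ) + s0 D + v * I)‖ * ‖omegaW D ((alpha D : ℂ) + s0 D + v * I)‖) +
            (∑ x ∈ T, ∫ v in (-ell1 D)..ell1 D,
              ‖H x (((-alpha D : ℝ) : ℂ) + s0 D + v * I)‖ *
                ‖omegaW D (((-alpha D : ℝ) : ℂ) + s0 D + v * I)‖)) +
          T.card * (K * Hmax * Real.exp (-(ell D ^ 10 / 8))) := by
        rw [Finset.sum_add_distrib, Finset.sum_const, nsmul_eq_mul, ← Finset.mul_sum,
          Finset.sum_add_distrib]
    _ ≤ C₇ * ell D ^ 9 * (frakP D * S * (2 * π * Real.exp (1 / 4)) +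
            frakP D * S * (2 * π * Real.exp (1 / 4))) +
          frakP D * (K * Hmax * Real.exp (-(ell D ^ 10 / 8))) := by
        have hαc : ((alpha D : ℝ) : ℂ) = (alpha D : ℂ) := rfl
        gcongr
        · exact hline (alpha D) (Or.inl rfl)
        · exact hline (-alpha D) (Or.inr rfl)
    _ = 2 * (C₇ * (2 * π * Real.exp (1 / 4))) * ell D ^ 9 * frakP D * S +
          K * frakP D * (Cmax * bigP D) ^ 2 * Real.exp (-(ell D ^ 10 / 8)) := by rw [hHmax]; ring

/-- **The quadratic zero-sum bound for every sufficiently large `c′`, NO hypothesis** (Prop. 2.2 is a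
tree theorem for large `c′`: `Skeleton.prop22_eventually`). [cite: Zhang2022LandauSiegel, §13 p.75] -/
theorem zeroSum_dirPoly_sq_le_eventually : ∃ c₀ : ℝ, 0 ≤ c₀ ∧ ∀ c' : ℝ, c₀ ≤ c' →
    ∃ K : ℝ, 0 ≤ K ∧ ∃ C : ℝ, 0 ≤ C ∧ ForAllLarge fun D _ χ => ∀ (c : ℕ → ℂ) (Cmax : ℝ),
      0 ≤ Cmax → (∀ n, ‖c n‖ ≤ Cmax) →
      (∑ x ∈ finsetOf (PsiOne χ), ∑ ρ ∈ finsetOf (zeroSet D x),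
          ‖x.ψ.LFunction (ρ + beta1 c' D) / deriv x.ψ.LFunction ρ‖ *
            ‖∑ n ∈ Finset.Icc 1 ⌊bigP D⌋₊, c n * x.ψ (n : ZMod x.p) * (n : ℂ) ^ (-ρ)‖ ^ 2 *
              ‖omegaW D ρ‖) ≤
        C * ell D ^ 9 * frakP D *
            (∑ n ∈ Finset.Icc 1 ⌊bigP D⌋₊,
              ‖c n‖ ^ 2 * ((n : ℝ) ^ (-(1 + 2 * alpha D)) + (n : ℝ) ^ (-(1 - 2 * alpha D)))) +
          K * frakP D * (Cmax * bigP D) ^ 2 * Real.exp (-(ell D ^ 10 / 8)) := by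
  obtain ⟨c₀, hc₀, h⟩ := prop22_eventually
  exact ⟨c₀, hc₀, fun c' hc' => zeroSum_dirPoly_sq_le_of_prop22 (hc₀.trans hc') (h c' hc')⟩

end Literature.NumberTheory.LFunctions.Zhang2022.Typed.Section13

end
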